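import Literature.Algebra.Homology.InducedModuleRecognition
import Mathlib.Algebra.DirectSum.Module
import Mathlib.LinearAlgebra.Isomorphisms
import HarnessLib

/-!
# Shapiro's lemma in degree zero with a character: the `χ`-coinvariants of a module which is the direct sum of summands permuted
# TRANSITIVELY by the acting group are the `χ`-coinvariants of ONE summand under its isotropy group —
# `(⊕_{i} M_i)_{Υ,χ} ≅ (M_{i₀})_{Υ_{i₀},χ}`, with the residual action and an explicit inverse (Brown, *Cohomology of Groups* III (5.3)–(5.4), (6.2))

Topic `Algebra/Homology`; namespace `Literature.Algebra.Homology.InducedModule` (the tree's Brown III §5 cluster: `InducedModuleRecognition`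
— `⊕ M_i` permuted transitively IS `Ind_{G_{i₀}}^G M_{i₀}`, (5.3), whose setting `N`, `M : I → Submodule k V`, `hperm`, `i₀` and lemma
`apply_mem_of_mem` are reused here (same universe convention `Type u`) —, `InducedModuleCosetDecomposition`, `InductionAlongQuotientCoinvariants`,
`InducedModuleMackey`).  Definitions with bodies and theorems; NO named fact, no `sorry`, no instance, no notation.

Source.  K. S. Brown, *Cohomology of Groups*, GTM 87 (1982), III §5 (5.3) (recognition of induced modules: a direct sum of summands permuted
transitively is `Ind_H^G M`, `H` the isotropy group of a summand), (5.4) (the same for the restriction to a subgroup acting on the summands: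
`Res ⊕ M_i ≅ ⊕_{orbits} Ind`), §6 (6.2) Shapiro's lemma `H_*(H, M) ≅ H_*(G, Ind_H^G M)` — in degree `0`: `M_H ≅ (Ind_H^G M)_G`, the coinvariants
(II §2) — and III §5 Exercise 2 / (5.6) for coefficients twisted by a character.  Assembled: if a group `Υ` acts (through `φ : Υ → G`) on
`V = ⊕_{i ∈ I} M_i` permuting the summands TRANSITIVELY, then `V = Ind_{Υ_{i₀}}^Υ M_{i₀}` as a `Υ`-module and, for a character
`χ : Υ → k^×`, the `χ`-coinvariants `V_{Υ,χ} := V/⟨u·v − χ(u)v⟩ = (V ⊗ χ⁻¹)_Υ` are `(M_{i₀} ⊗ χ⁻¹)_{Υ_{i₀}} = (M_{i₀})_{Υ_{i₀},χ}` by Shapiro.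
We give the isomorphism directly (no passage through `k[Υ] ⊗`), with its inverse
`P[v] = Σ_i χ(s_i)·[s_i⁻¹ v_i]` (`v = Σ v_i`, `s_i ∈ Υ` carrying `i₀` to `i`) — Brown's proof of (5.3)/(5.4) read on `H₀`.

WHY (cell `bsd-print-cf2`, route C, brick §4(c)/(e) dictionary D5, memos BRICK-C-FRAME-g19 §4 and BRICK-C-PADIC-g20 F26).  The semi-local
units `U_∞ = ∏_{𝔓 ∣ 𝔭} U_𝔓` of a `ℤ_p^2`-tower (Rubin 1991 §4, de Shalit III §1.3) are the direct sum of the summands `U_𝔓` permuted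
transitively by `G = Gal(F_∞/K)` with isotropy the decomposition group `D`; the two-variable main conjecture consumes the `χ`-COINVARIANTS
`(U_∞/𝒞̄)_χ` under the torsion subgroup (`SemilocalUnitData₂.Coinv χ`, `χ : Υ →* ℤˣ`), while the Coleman theory of the cell computes at ONE prime
`𝔓`.  When `Υ` (the group defining the coinvariants) is itself transitive on the primes above `𝔭` — `D·Υ = G` — this file is the passage:
`(U_∞)_{Υ,χ} ≅ (U_𝔓)_{Υ ∩ D, χ}`, equivariantly for the residual action of `D` (§4), and for a `G`-submodule `𝒞̄ ≤ U_∞` the coinvariants of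
`U_∞/𝒞̄` are `(U_𝔓)_{Υ∩D,χ}` modulo the EXPLICIT image `P(𝒞̄)` (§5) — for an elliptic unit `e(𝔞) = (e(𝔞)_{𝔓'})_{𝔓'}` this image is
`Σ_t χ(t)·[(e(𝔞)^{t⁻¹})_𝔓]`, the `χ`-weighted sum of the `𝔓`-components of its conjugates (F26).  Pure algebra here; no number theory.

## What is formalised (`k` a commutative ring, `G` a group, `N : Representation k G V`, `φ : Υ →* G`, `χ : Υ →* kˣ`)

* §1 `twistRel N φ χ = ⟨N(φ u) v − χ(u) v⟩` (the `χ`-coinvariant relations), `mkQ_apply_eq_smul` (`[φ(u)·v] = χ(u)[v]`), `twistRel_le_comap_of_commute`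
  (the relations are stable under every `g` commuting with `φ(Υ)`), `coinvAct`, **`coinvRep : Representation k G (V ⧸ twistRel N φ χ)`** (the residual
  action when `φ(Υ)` is central, e.g. `G` commutative).
* §2 (summands `M : I → Submodule k V` over a `G`-set `I` with `g M_i ⊆ M_{g i}`, base point `i₀`) `stabPre φ i₀ = φ⁻¹(G_{i₀})`,
  `isotropyRep` (the action of `φ⁻¹(G_{i₀})` on `M_{i₀}`), `twistRel₀` (its `χ`-relations), **`shapiroMap`** (`[m] ↦ [m]`, induced by `M_{i₀} ↪ V`).
* §3 (`DirectSum.IsInternal M` and a SECTION `s : I → Υ`, `φ(s i)·i₀ = i` — i.e. `Υ` transitive on `I`) `toSummand` (`v ↦ φ(s_i)⁻¹ v : M_i → M_{i₀}`),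
  `shapiroInvAux` / **`shapiroInv`** (`P[v] = Σ_i χ(s_i)·[φ(s_i)⁻¹ v_i]`), `shapiroInvAux_apply_of_mem`, `shapiroInvAux_apply_apply`
  (`P(φ(u)v) = χ(u)P(v)` — the cocycle computation `s_{u i}⁻¹ · u · s_i ∈ φ⁻¹(G_{i₀})`), ★★★ **`shapiroEquiv : (M_{i₀} ⧸ twistRel₀) ≃ₗ[k] (V ⧸ twistRel)`**
  (Shapiro's lemma in degree `0` with the character `χ`), `shapiroEquiv_symm_mk_of_mem` (the inverse on a summand).
* §4 **equivariance**: `shapiroMap_restrict` / `shapiroInv_coinvAct` — for `g ∈ G` fixing `i₀` and commuting with `φ(Υ)`,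
  `shapiroMap [g m] = g · shapiroMap [m]` (the residual action of the decomposition group matches).
* §5 **with a submodule**: for ANY `k`-submodule `C ≤ V`, ★★ **`quotientSupTwistRelEquiv : V ⧸ (C ⊔ twistRel) ≃ₗ[k] (M_{i₀} ⧸ twistRel₀) ⧸ P(C)`**,
  `P(C) = C.map (shapiroInv ∘ mkQ)` — the `χ`-coinvariants of `V/C` in terms of the one summand and the explicit projection of `C`.
* §6 (appended) transport along an equivariant map `π : V → W`: `twistRel_map_le`, `twistRel_map_eq_of_surjective`, and for `π` SURJECTIVE
  ★★ **`quotTwistRelEquivOfSurjective : W ⧸ twistRel ≃ₗ[k] V ⧸ (ker π ⊔ twistRel)`** — the `χ`-coinvariants of an equivariant quotient (e.g. of the module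
  `U_∞/𝒞̄` of a `SemilocalUnitData₂`, `π : U_∞ ↠ U_∞/𝒞̄`), to be composed with §5.
* §7 (appended) NATURALITY under an equivariant map `f : V' → V` of decomposed modules (different ambient groups `G' → G`, same `Υ`) carrying the base
  summand into the base summand: `coinvMapOfEquivariant`, `summandMapOfLE`, `coinvMap₀OfEquivariant`, ★ `shapiroMap_comp_coinvMap₀OfEquivariant`,
  ★ `shapiroInv_comp_coinvMapOfEquivariant` — the levelwise Shapiro isomorphisms of a tower (norm transitions) form a map of inverse systems.

## References
* K. S. Brown, *Cohomology of Groups*, GTM 87, Springer (1982), II §2 (coinvariants); III §5 Prop. (5.3), (5.4), (5.6), Exercise 2; III §6 (6.2)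
  (Shapiro's lemma). [Brown1982CohomologyGroups]
* E. de Shalit, *Iwasawa theory of elliptic curves with complex multiplication* (1987), III §1.3 (`U = ∏_{𝔓∣𝔭} U_𝔓`). [deShalit1987]
* K. Rubin, Invent. Math. 103 (1991), §4 (`U(F) = ∏_{w∣𝔭}`, the `χ`-parts). [Rubin1991]
-/

noncomputable section

universe u

namespace Literature.Algebra.Homology

namespace InducedModule

open Representation DirectSum

variable {k G : Type u} [CommRing k] [Group G] {V : Type u} [AddCommGroup V] [Module k V]
  (N : Representation k G V) {Υ : Type u} [Group Υ] (φ : Υ →* G) (χ : Υ →* kˣ)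

/-! ## §1. The `χ`-coinvariant relations and the residual action -/

/-- **The `χ`-coinvariant relations `⟨φ(u)·v − χ(u)v : u ∈ Υ, v ∈ V⟩`** — the submodule by which `V_{Υ,χ} = V ⊗_{k[Υ],χ} k` divides
(Brown II §2 with coefficients twisted by `χ`; for `χ = 1` Mathlib's `Representation.Coinvariants.ker`). [cite: Brown1982CohomologyGroups, II §2; III §5 Exercise 2] -/
def twistRel : Submodule k V :=
  Submodule.span k {x | ∃ (u : Υ) (v : V), x = N (φ u) v - ((χ u : kˣ) : k) • v}

/-- The generators lie in `twistRel`. [cite: Brown1982CohomologyGroups, II §2] -/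
theorem apply_sub_smul_mem_twistRel (u : Υ) (v : V) : N (φ u) v - ((χ u : kˣ) : k) • v ∈ twistRel N φ χ :=
  Submodule.subset_span ⟨u, v, rfl⟩

/-- **`[φ(u)·v] = χ(u)·[v]`** in `V ⧸ twistRel`. [cite: Brown1982CohomologyGroups, II §2] -/
theorem mkQ_apply_eq_smul (u : Υ) (v : V) :
    (twistRel N φ χ).mkQ (N (φ u) v) = ((χ u : kˣ) : k) • (twistRel N φ χ).mkQ v := by
  rw [← sub_eq_zero, ← map_smul, ← map_sub, Submodule.mkQ_apply, Submodule.Quotient.mk_eq_zero]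
  exact apply_sub_smul_mem_twistRel N φ χ u v

/-- `[φ(u)⁻¹·v] = χ(u)⁻¹·[v]`. [cite: Brown1982CohomologyGroups, II §2] -/
theorem mkQ_apply_inv_eq_smul (u : Υ) (v : V) :
    (twistRel N φ χ).mkQ (N (φ u)⁻¹ v) = (((χ u)⁻¹ : kˣ) : k) • (twistRel N φ χ).mkQ v := by
  rw [← map_inv, ← map_inv, mkQ_apply_eq_smul]

/-- **The relations are stable under every `g ∈ G` commuting with `φ(Υ)`** (`g(φ(u)v − χ(u)v) = φ(u)(gv) − χ(u)(gv)`; e.g. `G` commutative).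
[cite: Brown1982CohomologyGroups, II §2 Exercise 3 (a)] -/
theorem twistRel_le_comap_of_commute (g : G) (hg : ∀ u : Υ, Commute (φ u) g) : twistRel N φ χ ≤ (twistRel N φ χ).comap (N g) := by
  rw [twistRel, Submodule.span_le]
  rintro x ⟨u, v, rfl⟩
  rw [SetLike.mem_coe, Submodule.mem_comap, map_sub, map_smul, ← Module.End.mul_apply, ← map_mul, ← (hg u).eq, map_mul,
    Module.End.mul_apply]
  exact apply_sub_smul_mem_twistRel N φ χ u (N g v)

/-- **The residual action on the `χ`-coinvariants** of an element `g ∈ G` commuting with `φ(Υ)`: `g·[v] = [gv]`.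
[cite: Brown1982CohomologyGroups, II §2 Exercise 3 (a)] -/
def coinvAct (g : G) (hg : ∀ u : Υ, Commute (φ u) g) : (V ⧸ twistRel N φ χ) →ₗ[k] (V ⧸ twistRel N φ χ) :=
  (twistRel N φ χ).mapQ _ (N g) (twistRel_le_comap_of_commute N φ χ g hg)

/-- `coinvAct g [v] = [g v]`. [cite: Brown1982CohomologyGroups, II §2 Exercise 3 (a)] -/
@[simp] theorem coinvAct_mk (g : G) (hg : ∀ u : Υ, Commute (φ u) g) (v : V) :
    coinvAct N φ χ g hg (Submodule.Quotient.mk v) = Submodule.Quotient.mk (N g v) := rfl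

/-- **The residual representation of `G` on `V ⧸ twistRel`** when `φ(Υ)` is central (e.g. `G` commutative — the abelian Galois group of the CM tower).
[cite: Brown1982CohomologyGroups, II §2 Exercise 3 (a)] -/
def coinvRep (hcomm : ∀ (u : Υ) (g : G), Commute (φ u) g) : Representation k G (V ⧸ twistRel N φ χ) :=
  N.quotient (twistRel N φ χ) fun g => twistRel_le_comap_of_commute N φ χ g fun u => hcomm u g

/-- `coinvRep g [v] = [g v]`. [cite: Brown1982CohomologyGroups, II §2 Exercise 3 (a)] -/
@[simp] theorem coinvRep_mk (hcomm : ∀ (u : Υ) (g : G), Commute (φ u) g) (g : G) (v : V) :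
    coinvRep N φ χ hcomm g (Submodule.Quotient.mk v) = Submodule.Quotient.mk (N g v) := rfl

/-- On the coinvariants `φ(u)` acts as the scalar `χ(u)`. [cite: Brown1982CohomologyGroups, II §2] -/
theorem coinvRep_apply_eq_smul (hcomm : ∀ (u : Υ) (g : G), Commute (φ u) g) (u : Υ) (x : V ⧸ twistRel N φ χ) :
    coinvRep N φ χ hcomm (φ u) x = ((χ u : kˣ) : k) • x := by
  induction x using Submodule.Quotient.induction_on with
  | H v => exact mkQ_apply_eq_smul N φ χ u v

/-! ## §2. One summand and its isotropy group -/

variable {I : Type u} [MulAction G I] (M : I → Submodule k V) (hperm : ∀ (g : G) (i : I), (M i).map (N g) ≤ M (g • i)) (i₀ : I)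

/-- **`φ⁻¹(G_{i₀})`**: the elements of `Υ` fixing `i₀` — the isotropy group of the summand `M_{i₀}` in `Υ` (the decomposition group met by `Υ`).
[cite: Brown1982CohomologyGroups, III §5 Prop. (5.3), (5.4)] -/
def stabPre : Subgroup Υ := (MulAction.stabilizer G i₀).comap φ

/-- Membership in `stabPre`. [cite: Brown1982CohomologyGroups, III §5 Prop. (5.4)] -/
theorem mem_stabPre_iff (u : Υ) : u ∈ stabPre φ i₀ ↔ φ u • i₀ = i₀ := Iff.rfl

/-- **"`M_{i₀}` is a `φ⁻¹(G_{i₀})`-module"**: the action of the isotropy group on the summand. [cite: Brown1982CohomologyGroups, III §5 Prop. (5.3)] -/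
def isotropyRep : Representation k (stabPre φ i₀) (M i₀) :=
  Representation.subrepresentation (N.comp (φ.comp (stabPre φ i₀).subtype)) (M i₀) fun u v hv => by
    have h := apply_mem_of_mem N M hperm (φ (u : Υ)) hv
    rwa [(mem_stabPre_iff φ i₀ (u : Υ)).mp u.2] at h

/-- `isotropyRep u m = φ(u) m` (computed in `V`). [cite: Brown1982CohomologyGroups, III §5 Prop. (5.3)] -/
@[simp] theorem coe_isotropyRep_apply (u : stabPre φ i₀) (m : M i₀) : (isotropyRep N φ M hperm i₀ u m : V) = N (φ (u : Υ)) m := rfl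

/-- **The `χ`-relations on the summand**, `⟨φ(u)·m − χ(u)m : u ∈ φ⁻¹(G_{i₀}), m ∈ M_{i₀}⟩` (§1 for `isotropyRep` and `χ|`).
[cite: Brown1982CohomologyGroups, II §2; III §5 Exercise 2] -/
abbrev twistRel₀ : Submodule k (M i₀) :=
  twistRel (isotropyRep N φ M hperm i₀) (MonoidHom.id (stabPre φ i₀)) (χ.comp (stabPre φ i₀).subtype)

/-- The relations on the summand map into the relations on `V`. [cite: Brown1982CohomologyGroups, III §6 (6.2)] -/
theorem twistRel₀_le_comap : twistRel₀ N φ χ M hperm i₀ ≤ (twistRel N φ χ).comap (M i₀).subtype := by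
  refine Submodule.span_le.mpr ?_
  rintro x ⟨u, m, rfl⟩
  rw [SetLike.mem_coe, Submodule.mem_comap, map_sub, map_smul, Submodule.subtype_apply, Submodule.subtype_apply, MonoidHom.id_apply,
    coe_isotropyRep_apply, MonoidHom.comp_apply, Subgroup.subtype_apply]
  exact apply_sub_smul_mem_twistRel N φ χ (u : Υ) (m : V)

/-- **The Shapiro map `(M_{i₀})_{χ} → V_{χ}`, `[m] ↦ [m]`** (induced by the inclusion of the summand). [cite: Brown1982CohomologyGroups, III §6 (6.2)] -/
def shapiroMap : (M i₀ ⧸ twistRel₀ N φ χ M hperm i₀) →ₗ[k] (V ⧸ twistRel N φ χ) :=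
  Submodule.mapQ _ _ (M i₀).subtype (twistRel₀_le_comap N φ χ M hperm i₀)

/-- `shapiroMap [m] = [m]`. [cite: Brown1982CohomologyGroups, III §6 (6.2)] -/
@[simp] theorem shapiroMap_mk (m : M i₀) :
    shapiroMap N φ χ M hperm i₀ (Submodule.Quotient.mk m) = Submodule.Quotient.mk (m : V) := rfl

/-! ## §3. Transitivity: the explicit inverse `P[v] = Σ_i χ(s_i)·[φ(s_i)⁻¹ v_i]` and the isomorphism -/

variable (s : I → Υ) (hs : ∀ i, φ (s i) • i₀ = i)

include hs in
/-- The cocycle element: `s_{u·i}⁻¹ · u · s_i` fixes `i₀`. [cite: Brown1982CohomologyGroups, III §5 Prop. (5.3), §9 (A)] -/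
theorem inv_mul_mul_mem_stabPre (u : Υ) (i : I) : (s (φ u • i))⁻¹ * u * s i ∈ stabPre φ i₀ := by
  rw [mem_stabPre_iff, map_mul, map_mul, map_inv, mul_smul, mul_smul, hs i, inv_smul_eq_iff, hs (φ u • i)]

/-- In `(M_{i₀})_{χ}`: `[φ(e) m] = χ(e)·[m]` for `e ∈ φ⁻¹(G_{i₀})` (§1 on the summand). [cite: Brown1982CohomologyGroups, II §2] -/
theorem mkQ₀_apply_eq_smul (e : stabPre φ i₀) (m : M i₀) :
    (twistRel₀ N φ χ M hperm i₀).mkQ (isotropyRep N φ M hperm i₀ e m) = ((χ (e : Υ) : kˣ) : k) • (twistRel₀ N φ χ M hperm i₀).mkQ m :=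
  mkQ_apply_eq_smul (isotropyRep N φ M hperm i₀) (MonoidHom.id (stabPre φ i₀)) (χ.comp (stabPre φ i₀).subtype) e m

include hperm hs in
/-- `φ(s_i)⁻¹ v ∈ M_{i₀}` for `v ∈ M_i`. [cite: Brown1982CohomologyGroups, III §5 Prop. (5.3)] -/
theorem apply_inv_mem_of_mem (i : I) {v : V} (hv : v ∈ M i) : N (φ (s i))⁻¹ v ∈ M i₀ := by
  have h := apply_mem_of_mem N M hperm (φ (s i))⁻¹ hv
  rwa [inv_smul_eq_iff.mpr (hs i).symm] at h

/-- **`toSummand i : M_i → M_{i₀}`, `v ↦ φ(s_i)⁻¹ v`** (transport of the summand `M_i = s_i M_{i₀}` back to `M_{i₀}`).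
[cite: Brown1982CohomologyGroups, III §5 Prop. (5.3) ("`v ↦ g ⊗ g⁻¹v`")] -/
def toSummand (i : I) : M i →ₗ[k] M i₀ :=
  LinearMap.codRestrict (M i₀) ((N (φ (s i))⁻¹).comp (M i).subtype) fun v => apply_inv_mem_of_mem N φ M hperm i₀ s hs i v.2

/-- `toSummand i v = φ(s_i)⁻¹ v` in `V`. [cite: Brown1982CohomologyGroups, III §5 Prop. (5.3)] -/
@[simp] theorem coe_toSummand (i : I) (v : M i) : (toSummand N φ M hperm i₀ s hs i v : V) = N (φ (s i))⁻¹ v := rfl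

variable [DecidableEq I] (hint : DirectSum.IsInternal M)

/-- The inverse on the external direct sum: `(v_i)_i ↦ Σ_i χ(s_i)·[φ(s_i)⁻¹ v_i]`. [cite: Brown1982CohomologyGroups, III §5 Prop. (5.3), §6 (6.2)] -/
def shapiroInvSum : (⨁ i, M i) →ₗ[k] (M i₀ ⧸ twistRel₀ N φ χ M hperm i₀) :=
  DirectSum.toModule k I _ fun i => ((χ (s i) : kˣ) : k) • ((twistRel₀ N φ χ M hperm i₀).mkQ ∘ₗ toSummand N φ M hperm i₀ s hs i)

/-- **`P₀ : V → (M_{i₀})_{χ}`, `v = Σ v_i ↦ Σ_i χ(s_i)·[φ(s_i)⁻¹ v_i]`** (through the decomposition `V ≅ ⊕ M_i`).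
[cite: Brown1982CohomologyGroups, III §5 Prop. (5.3), §6 (6.2)] -/
def shapiroInvAux : V →ₗ[k] (M i₀ ⧸ twistRel₀ N φ χ M hperm i₀) :=
  shapiroInvSum N φ χ M hperm i₀ s hs ∘ₗ ((LinearEquiv.ofBijective (DirectSum.coeLinearMap M) hint).symm : V →ₗ[k] ⨁ i, M i)

/-- The decomposition of an element of a summand is the single term. [cite: Brown1982CohomologyGroups, III §5 (5.2)] -/
theorem ofBijective_symm_apply_of_mem {i : I} {v : V} (hv : v ∈ M i) :
    (LinearEquiv.ofBijective (DirectSum.coeLinearMap M) hint).symm v = DirectSum.lof k I (fun i => M i) i ⟨v, hv⟩ := by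
  rw [LinearEquiv.symm_apply_eq, LinearEquiv.ofBijective_apply, DirectSum.coeLinearMap_lof]

/-- **`P₀ v = χ(s_i)·[φ(s_i)⁻¹ v]` for `v ∈ M_i`.** [cite: Brown1982CohomologyGroups, III §5 Prop. (5.3), §6 (6.2)] -/
theorem shapiroInvAux_apply_of_mem {i : I} {v : V} (hv : v ∈ M i) :
    shapiroInvAux N φ χ M hperm i₀ s hs hint v =
      ((χ (s i) : kˣ) : k) • (twistRel₀ N φ χ M hperm i₀).mkQ (toSummand N φ M hperm i₀ s hs i ⟨v, hv⟩) := by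
  rw [shapiroInvAux, LinearMap.comp_apply, LinearEquiv.coe_coe, ofBijective_symm_apply_of_mem M hint hv, shapiroInvSum, DirectSum.toModule_lof,
    LinearMap.smul_apply, LinearMap.comp_apply]

/-- **`P₀(φ(u) v) = χ(u)·P₀(v)`** — `P₀` kills the `χ`-relations (on a summand `M_i`: `φ(s_{ui})⁻¹ φ(u) v = φ(e)(φ(s_i)⁻¹ v)` with
`e = s_{ui}⁻¹ u s_i ∈ φ⁻¹(G_{i₀})`, and `χ(s_{ui})χ(e) = χ(u)χ(s_i)`). [cite: Brown1982CohomologyGroups, III §5 Prop. (5.3), §6 (6.2), §9 (A)] -/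
theorem shapiroInvAux_apply_apply (u : Υ) (v : V) :
    shapiroInvAux N φ χ M hperm i₀ s hs hint (N (φ u) v) = ((χ u : kˣ) : k) • shapiroInvAux N φ χ M hperm i₀ s hs hint v := by
  -- as linear maps, on the spanning family `⋃ M i`
  suffices h : shapiroInvAux N φ χ M hperm i₀ s hs hint ∘ₗ N (φ u) = ((χ u : kˣ) : k) • shapiroInvAux N φ χ M hperm i₀ s hs hint from
    LinearMap.congr_fun h v
  refine LinearMap.ext_on (s := ⋃ i, (M i : Set V)) ?_ ?_
  · rw [← Submodule.iSup_eq_span]; exact hint.submodule_iSup_eq_top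
  rintro w hw
  obtain ⟨i, hw⟩ := Set.mem_iUnion.mp hw
  have hw' : N (φ u) w ∈ M (φ u • i) := apply_mem_of_mem N M hperm (φ u) hw
  rw [LinearMap.comp_apply, LinearMap.smul_apply, shapiroInvAux_apply_of_mem N φ χ M hperm i₀ s hs hint hw',
    shapiroInvAux_apply_of_mem N φ χ M hperm i₀ s hs hint hw, smul_smul]
  -- `toSummand (u i) (φ u w) = isotropyRep e (toSummand i w)`
  have he := inv_mul_mul_mem_stabPre φ i₀ s hs u i
  have key : toSummand N φ M hperm i₀ s hs (φ u • i) ⟨N (φ u) w, hw'⟩ =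
      isotropyRep N φ M hperm i₀ ⟨_, he⟩ (toSummand N φ M hperm i₀ s hs i ⟨w, hw⟩) := by
    apply Subtype.ext
    simp only [coe_toSummand, coe_isotropyRep_apply, map_mul, map_inv, Module.End.mul_apply, Representation.self_inv_apply]
  rw [key, mkQ₀_apply_eq_smul, smul_smul]
  congr 1
  rw [← Units.val_mul, ← Units.val_mul, ← map_mul, ← map_mul]
  simp only [mul_assoc, mul_inv_cancel_left]

/-- The relations of `V` lie in the kernel of `P₀`. [cite: Brown1982CohomologyGroups, III §6 (6.2)] -/
theorem twistRel_le_ker_shapiroInvAux : twistRel N φ χ ≤ LinearMap.ker (shapiroInvAux N φ χ M hperm i₀ s hs hint) := by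
  rw [twistRel, Submodule.span_le]
  rintro x ⟨u, v, rfl⟩
  rw [SetLike.mem_coe, LinearMap.mem_ker, map_sub, map_smul, shapiroInvAux_apply_apply, sub_self]

/-- **`P : V_{χ} → (M_{i₀})_{χ}`, `[v] ↦ Σ_i χ(s_i)·[φ(s_i)⁻¹ v_i]`** — the inverse of the Shapiro map. [cite: Brown1982CohomologyGroups, III §6 (6.2)] -/
def shapiroInv : (V ⧸ twistRel N φ χ) →ₗ[k] (M i₀ ⧸ twistRel₀ N φ χ M hperm i₀) :=
  (twistRel N φ χ).liftQ (shapiroInvAux N φ χ M hperm i₀ s hs hint) (twistRel_le_ker_shapiroInvAux N φ χ M hperm i₀ s hs hint)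

/-- `P [v] = P₀ v`. [cite: Brown1982CohomologyGroups, III §6 (6.2)] -/
@[simp] theorem shapiroInv_mk (v : V) :
    shapiroInv N φ χ M hperm i₀ s hs hint (Submodule.Quotient.mk v) = shapiroInvAux N φ χ M hperm i₀ s hs hint v := rfl

/-- `P ∘ shapiroMap = id` (`χ(s_{i₀})·χ(s_{i₀})⁻¹ = 1`). [cite: Brown1982CohomologyGroups, III §6 (6.2)] -/
theorem shapiroInv_shapiroMap (x : M i₀ ⧸ twistRel₀ N φ χ M hperm i₀) :
    shapiroInv N φ χ M hperm i₀ s hs hint (shapiroMap N φ χ M hperm i₀ x) = x := by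
  induction x using Submodule.Quotient.induction_on with
  | H m =>
    rw [shapiroMap_mk, shapiroInv_mk, shapiroInvAux_apply_of_mem N φ χ M hperm i₀ s hs hint m.2]
    have he : (s i₀)⁻¹ ∈ stabPre φ i₀ := by
      rw [mem_stabPre_iff, map_inv, inv_smul_eq_iff, hs i₀]
    have key : toSummand N φ M hperm i₀ s hs i₀ ⟨(m : V), m.2⟩ = isotropyRep N φ M hperm i₀ ⟨_, he⟩ m :=
      Subtype.ext (by simp only [coe_toSummand, coe_isotropyRep_apply, map_inv])
    rw [key, mkQ₀_apply_eq_smul, smul_smul, ← Units.val_mul, ← map_mul, mul_inv_cancel, map_one, Units.val_one, one_smul]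
    rfl

/-- `shapiroMap ∘ P = id` (`[v_i] = [φ(s_i)(φ(s_i)⁻¹ v_i)] = χ(s_i)[φ(s_i)⁻¹ v_i]`). [cite: Brown1982CohomologyGroups, III §6 (6.2)] -/
theorem shapiroMap_shapiroInv (x : V ⧸ twistRel N φ χ) :
    shapiroMap N φ χ M hperm i₀ (shapiroInv N φ χ M hperm i₀ s hs hint x) = x := by
  induction x using Submodule.Quotient.induction_on with
  | H v =>
    -- as linear maps `V → V ⧸ twistRel`, on the spanning family `⋃ M i`
    suffices h : shapiroMap N φ χ M hperm i₀ ∘ₗ shapiroInvAux N φ χ M hperm i₀ s hs hint = (twistRel N φ χ).mkQ from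
      LinearMap.congr_fun h v
    refine LinearMap.ext_on (s := ⋃ i, (M i : Set V)) ?_ ?_
    · rw [← Submodule.iSup_eq_span]; exact hint.submodule_iSup_eq_top
    rintro w hw
    obtain ⟨i, hw⟩ := Set.mem_iUnion.mp hw
    rw [LinearMap.comp_apply, shapiroInvAux_apply_of_mem N φ χ M hperm i₀ s hs hint hw, map_smul, Submodule.mkQ_apply, shapiroMap_mk,
      coe_toSummand]
    change ((χ (s i) : kˣ) : k) • (twistRel N φ χ).mkQ (N (φ (s i))⁻¹ w) = (twistRel N φ χ).mkQ w
    rw [mkQ_apply_inv_eq_smul, smul_smul, ← Units.val_mul, mul_inv_cancel, Units.val_one, one_smul]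

/-- ★★★ **SHAPIRO'S LEMMA IN DEGREE ZERO WITH A CHARACTER**: if `Υ` acts on `V = ⊕_{i ∈ I} M_i` (internal direct sum, `φ(u) M_i ⊆ M_{φ(u) i}`)
permuting the summands TRANSITIVELY (a section `s : I → Υ`, `φ(s_i) i₀ = i`), then the inclusion `M_{i₀} ↪ V` induces an ISOMORPHISM of the
`χ`-coinvariants **`(M_{i₀})_{φ⁻¹(G_{i₀}), χ} ≅ V_{Υ, χ}`**, with inverse `[v] ↦ Σ_i χ(s_i)·[φ(s_i)⁻¹ v_i]`.  (`V = Ind M_{i₀}` by (5.3); degree `0` of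
(6.2) with coefficients twisted by `χ`.)  For the semi-local units: `(U_∞)_{χ} ≅ (U_𝔓)_{χ}` when the torsion group is transitive on the primes
above `𝔭`. [cite: Brown1982CohomologyGroups, III §5 Prop. (5.3), (5.4); III §6 (6.2)] -/
def shapiroEquiv : (M i₀ ⧸ twistRel₀ N φ χ M hperm i₀) ≃ₗ[k] (V ⧸ twistRel N φ χ) :=
  { shapiroMap N φ χ M hperm i₀ with
    invFun := shapiroInv N φ χ M hperm i₀ s hs hint
    left_inv := shapiroInv_shapiroMap N φ χ M hperm i₀ s hs hint
    right_inv := shapiroMap_shapiroInv N φ χ M hperm i₀ s hs hint }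

/-- `shapiroEquiv [m] = [m]`. [cite: Brown1982CohomologyGroups, III §6 (6.2)] -/
@[simp] theorem shapiroEquiv_apply (x : M i₀ ⧸ twistRel₀ N φ χ M hperm i₀) :
    shapiroEquiv N φ χ M hperm i₀ s hs hint x = shapiroMap N φ χ M hperm i₀ x := rfl

/-- `shapiroEquiv.symm = P`. [cite: Brown1982CohomologyGroups, III §6 (6.2)] -/
@[simp] theorem shapiroEquiv_symm_apply (x : V ⧸ twistRel N φ χ) :
    (shapiroEquiv N φ χ M hperm i₀ s hs hint).symm x = shapiroInv N φ χ M hperm i₀ s hs hint x := rfl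

/-- **The inverse on a summand**: `shapiroEquiv⁻¹ [v] = χ(s_i)·[φ(s_i)⁻¹ v]` for `v ∈ M_i` — for the semi-local units, the class of an element
supported at the prime `𝔓' = s_i 𝔓` is `χ(s_i)` times the class of its transport to `𝔓`. [cite: Brown1982CohomologyGroups, III §5 Prop. (5.3), §6 (6.2)] -/
theorem shapiroEquiv_symm_mk_of_mem {i : I} {v : V} (hv : v ∈ M i) :
    (shapiroEquiv N φ χ M hperm i₀ s hs hint).symm (Submodule.Quotient.mk v) =
      ((χ (s i) : kˣ) : k) • (twistRel₀ N φ χ M hperm i₀).mkQ (toSummand N φ M hperm i₀ s hs i ⟨v, hv⟩) :=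
  shapiroInvAux_apply_of_mem N φ χ M hperm i₀ s hs hint hv

include s hs hint in
/-- Bijectivity of the Shapiro map. [cite: Brown1982CohomologyGroups, III §6 (6.2)] -/
theorem shapiroMap_bijective : Function.Bijective (shapiroMap N φ χ M hperm i₀) :=
  (shapiroEquiv N φ χ M hperm i₀ s hs hint).bijective

/-! ## §4. Equivariance for the residual action of the isotropy group -/

omit [DecidableEq I] in
include hperm in
/-- `M_{i₀}` is stable under `g ∈ G` fixing `i₀`. [cite: Brown1982CohomologyGroups, III §5 Prop. (5.3)] -/
theorem summand_le_comap {g : G} (hg : g • i₀ = i₀) : M i₀ ≤ (M i₀).comap (N g) := fun v hv => by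
  have h := apply_mem_of_mem N M hperm g hv
  rwa [hg] at h

omit [DecidableEq I] in
/-- The `χ`-relations on the summand are stable under `g ∈ G` fixing `i₀` and commuting with `φ(Υ)`.
[cite: Brown1982CohomologyGroups, II §2 Exercise 3 (a)] -/
theorem twistRel₀_le_comap_restrict {g : G} (hg : g • i₀ = i₀) (hc : ∀ u : Υ, Commute (φ u) g) :
    twistRel₀ N φ χ M hperm i₀ ≤ (twistRel₀ N φ χ M hperm i₀).comap ((N g).restrict (summand_le_comap N M hperm i₀ hg)) := by
  refine Submodule.span_le.mpr ?_
  rintro x ⟨u, m, rfl⟩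
  rw [SetLike.mem_coe, Submodule.mem_comap, map_sub, map_smul]
  have key : (N g).restrict (summand_le_comap N M hperm i₀ hg) (isotropyRep N φ M hperm i₀ (MonoidHom.id _ u) m) =
      isotropyRep N φ M hperm i₀ (MonoidHom.id _ u) ((N g).restrict (summand_le_comap N M hperm i₀ hg) m) := by
    apply Subtype.ext
    rw [LinearMap.coe_restrict_apply, MonoidHom.id_apply, coe_isotropyRep_apply, coe_isotropyRep_apply, LinearMap.coe_restrict_apply,
      ← Module.End.mul_apply, ← map_mul, ← (hc (u : Υ)).eq, map_mul, Module.End.mul_apply]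
  rw [key]
  exact apply_sub_smul_mem_twistRel _ _ _ _ _

omit [DecidableEq I] in
/-- ★ **Equivariance**: for `g ∈ G` fixing `i₀` and commuting with `φ(Υ)`, `shapiroMap [g m] = g · shapiroMap [m]` — the Shapiro isomorphism intertwines
the residual action of the isotropy (decomposition) group on `(M_{i₀})_{χ}` with the residual action on `V_{χ}`.
[cite: Brown1982CohomologyGroups, III §5 Prop. (5.3), §6 (6.2)] -/
theorem shapiroMap_restrict {g : G} (hg : g • i₀ = i₀) (hc : ∀ u : Υ, Commute (φ u) g) (x : M i₀ ⧸ twistRel₀ N φ χ M hperm i₀) :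
    shapiroMap N φ χ M hperm i₀ ((twistRel₀ N φ χ M hperm i₀).mapQ _ ((N g).restrict (summand_le_comap N M hperm i₀ hg))
        (twistRel₀_le_comap_restrict N φ χ M hperm i₀ hg hc) x) =
      coinvAct N φ χ g hc (shapiroMap N φ χ M hperm i₀ x) := by
  induction x using Submodule.Quotient.induction_on with
  | H m => rfl

/-- ★ **Equivariance of the inverse**: `P (g · y) = g · P(y)` for `g` fixing `i₀` and commuting with `φ(Υ)`. [cite: Brown1982CohomologyGroups, III §6 (6.2)] -/
theorem shapiroInv_coinvAct {g : G} (hg : g • i₀ = i₀) (hc : ∀ u : Υ, Commute (φ u) g) (y : V ⧸ twistRel N φ χ) :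
    shapiroInv N φ χ M hperm i₀ s hs hint (coinvAct N φ χ g hc y) =
      (twistRel₀ N φ χ M hperm i₀).mapQ _ ((N g).restrict (summand_le_comap N M hperm i₀ hg))
        (twistRel₀_le_comap_restrict N φ χ M hperm i₀ hg hc) (shapiroInv N φ χ M hperm i₀ s hs hint y) := by
  obtain ⟨x, rfl⟩ := (shapiroMap_bijective N φ χ M hperm i₀ s hs hint).2 y
  rw [← shapiroMap_restrict N φ χ M hperm i₀ hg hc, shapiroInv_shapiroMap, shapiroInv_shapiroMap]

/-! ## §5. With a submodule: the `χ`-coinvariants of `V/C` -/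

/-- ★★ **The `χ`-coinvariants of a quotient `V/C`**: for ANY `k`-submodule `C ≤ V`,
**`V ⧸ (C ⊔ twistRel) ≅ (M_{i₀})_{χ} ⧸ P(C)`** with `P(C)` the image of `C` under `[v] ↦ Σ_i χ(s_i)·[φ(s_i)⁻¹ v_i]` — for the semi-local units modulo
the closure of the elliptic units, `(U_∞/𝒞̄)_{χ} ≅ (U_𝔓)_{χ} / P(𝒞̄)`, `P(e(𝔞)) = Σ_t χ(t)·[(e(𝔞)^{t⁻¹})_𝔓]` (the `χ`-weighted sum of the `𝔓`-components
of the conjugates). [cite: Brown1982CohomologyGroups, II §2, III §6 (6.2)] [cite: deShalit1987, III §1.3–1.4] -/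
def quotientSupTwistRelEquiv (C : Submodule k V) :
    (V ⧸ (C ⊔ twistRel N φ χ)) ≃ₗ[k]
      ((M i₀ ⧸ twistRel₀ N φ χ M hperm i₀) ⧸ C.map (shapiroInv N φ χ M hperm i₀ s hs hint ∘ₗ (twistRel N φ χ).mkQ)) :=
  (Submodule.quotEquivOfEq _ _ (sup_comm C (twistRel N φ χ))).trans <|
    ((Submodule.quotientQuotientEquivQuotient (twistRel N φ χ) (twistRel N φ χ ⊔ C) le_sup_left).symm.trans <|
      Submodule.Quotient.equiv _ _ (shapiroEquiv N φ χ M hperm i₀ s hs hint).symm (by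
        rw [Submodule.map_sup, Submodule.mkQ_map_self, bot_sup_eq, Submodule.map_comp]
        rfl))

/-- `quotientSupTwistRelEquiv [v] = [P [v]]`. [cite: Brown1982CohomologyGroups, III §6 (6.2)] -/
theorem quotientSupTwistRelEquiv_mk (C : Submodule k V) (v : V) :
    quotientSupTwistRelEquiv N φ χ M hperm i₀ s hs hint C (Submodule.Quotient.mk v) =
      Submodule.Quotient.mk (shapiroInv N φ χ M hperm i₀ s hs hint (Submodule.Quotient.mk v)) := rfl

/-! ## §6. Transport of the `χ`-relations along an equivariant map; the coinvariants of an equivariant QUOTIENT -/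

section Transport

variable {W : Type u} [AddCommGroup W] [Module k W] (N' : Representation k G W) (π : V →ₗ[k] W)
  (hπ : ∀ g : G, π ∘ₗ N g = N' g ∘ₗ π)

include hπ in
/-- The `χ`-relations map into the `χ`-relations along an equivariant map. [cite: Brown1982CohomologyGroups, II §2 (functoriality of `(·)_G`)] -/
theorem twistRel_map_le : (twistRel N φ χ).map π ≤ twistRel N' φ χ := by
  rw [twistRel, Submodule.map_span_le]
  rintro x ⟨u, v, rfl⟩
  rw [map_sub, map_smul, ← LinearMap.comp_apply, hπ, LinearMap.comp_apply]
  exact apply_sub_smul_mem_twistRel N' φ χ u (π v)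

include hπ in
/-- **Along an equivariant SURJECTION the `χ`-relations of the target are the image of those of the source.**
[cite: Brown1982CohomologyGroups, II §2 (right exactness of `(·)_G`)] -/
theorem twistRel_map_eq_of_surjective (hsurj : Function.Surjective π) : (twistRel N φ χ).map π = twistRel N' φ χ := by
  refine le_antisymm (twistRel_map_le N φ χ N' π hπ) ?_
  rw [twistRel, Submodule.span_le]
  rintro x ⟨u, w, rfl⟩
  obtain ⟨v, rfl⟩ := hsurj w
  refine ⟨N (φ u) v - ((χ u : kˣ) : k) • v, apply_sub_smul_mem_twistRel N φ χ u v, ?_⟩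
  rw [map_sub, map_smul, ← LinearMap.comp_apply, hπ, LinearMap.comp_apply]

include hπ in
/-- The kernel of `V → W → W_{χ}` is `ker π ⊔ twistRel` for an equivariant surjection `π`. [cite: Brown1982CohomologyGroups, II §2] -/
theorem ker_mkQ_comp_eq_sup_of_surjective (hsurj : Function.Surjective π) :
    LinearMap.ker ((twistRel N' φ χ).mkQ ∘ₗ π) = LinearMap.ker π ⊔ twistRel N φ χ := by
  rw [LinearMap.ker_comp, Submodule.ker_mkQ, ← twistRel_map_eq_of_surjective N φ χ N' π hπ hsurj, Submodule.comap_map_eq, sup_comm]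

/-- ★★ **THE `χ`-COINVARIANTS OF AN EQUIVARIANT QUOTIENT**: for an equivariant surjection `π : V ↠ W` (e.g. `U_∞ ↠ U_∞/𝒞̄`, the module of a
`SemilocalUnitData₂`), **`W_{χ} ≃ V ⧸ (ker π ⊔ twistRel)`** — composed with §5 (`V = ⊕ M_i`, `C = ker π`) this reads the coinvariants of the quotient on
ONE summand. [cite: Brown1982CohomologyGroups, II §2 (right exactness of `(·)_G`); III §6 (6.2)] -/
def quotTwistRelEquivOfSurjective (hsurj : Function.Surjective π) :
    (W ⧸ twistRel N' φ χ) ≃ₗ[k] V ⧸ (LinearMap.ker π ⊔ twistRel N φ χ) :=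
  (LinearMap.quotKerEquivOfSurjective ((twistRel N' φ χ).mkQ ∘ₗ π)
      ((Submodule.mkQ_surjective _).comp hsurj)).symm.trans
    (Submodule.quotEquivOfEq _ _ (ker_mkQ_comp_eq_sup_of_surjective N φ χ N' π hπ hsurj))

/-- `quotTwistRelEquivOfSurjective⁻¹ [v] = [π v]`. [cite: Brown1982CohomologyGroups, II §2] -/
@[simp] theorem quotTwistRelEquivOfSurjective_symm_mk (hsurj : Function.Surjective π) (v : V) :
    (quotTwistRelEquivOfSurjective N φ χ N' π hπ hsurj).symm (Submodule.Quotient.mk v) = Submodule.Quotient.mk (π v) := rfl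

/-- `quotTwistRelEquivOfSurjective [π v] = [v]`. [cite: Brown1982CohomologyGroups, II §2] -/
@[simp] theorem quotTwistRelEquivOfSurjective_mk_apply (hsurj : Function.Surjective π) (v : V) :
    quotTwistRelEquivOfSurjective N φ χ N' π hπ hsurj (Submodule.Quotient.mk (π v)) = Submodule.Quotient.mk v := by
  rw [← quotTwistRelEquivOfSurjective_symm_mk N φ χ N' π hπ hsurj v, LinearEquiv.apply_symm_apply]

end Transport

/-! ## §7. Naturality of the Shapiro map under equivariant maps of decomposed modules (e.g. the NORMS of a tower) -/

section Naturality

variable {G' : Type u} [Group G'] {V' : Type u} [AddCommGroup V'] [Module k V'] (N' : Representation k G' V') (φ' : Υ →* G')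
  {I' : Type u} [MulAction G' I'] (M' : I' → Submodule k V') (hperm' : ∀ (g : G') (i : I'), (M' i).map (N' g) ≤ M' (g • i)) (i₀' : I')
  (f : V' →ₗ[k] V) (hf : ∀ u : Υ, f ∘ₗ N' (φ' u) = N (φ u) ∘ₗ f)
  (hf₀ : (M' i₀').map f ≤ M i₀) (hstab : stabPre φ' i₀' ≤ stabPre φ i₀)

include hf in
/-- The `χ`-relations map into the `χ`-relations along a `Υ`-equivariant map between modules with DIFFERENT ambient groups `G' → G`
(`f ∘ φ'(u) = φ(u) ∘ f`; e.g. the norm `U(F_{n'}) → U(F_n)`). [cite: Brown1982CohomologyGroups, II §2 (functoriality of `(·)_G`)] -/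
theorem twistRel_map_le_of_equivariant : (twistRel N' φ' χ).map f ≤ twistRel N φ χ := by
  rw [twistRel, Submodule.map_span_le]
  rintro x ⟨u, v, rfl⟩
  rw [map_sub, map_smul, ← LinearMap.comp_apply, hf, LinearMap.comp_apply]
  exact apply_sub_smul_mem_twistRel N φ χ u (f v)

/-- **The map of `χ`-coinvariants `V'_{χ} → V_{χ}`** induced by an equivariant `f`. [cite: Brown1982CohomologyGroups, II §2] -/
def coinvMapOfEquivariant : (V' ⧸ twistRel N' φ' χ) →ₗ[k] (V ⧸ twistRel N φ χ) :=
  Submodule.mapQ _ _ f (Submodule.map_le_iff_le_comap.mp (twistRel_map_le_of_equivariant N φ χ N' φ' f hf))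

/-- `coinvMapOfEquivariant [v'] = [f v']`. [cite: Brown1982CohomologyGroups, II §2] -/
@[simp] theorem coinvMapOfEquivariant_mk (v' : V') :
    coinvMapOfEquivariant N φ χ N' φ' f hf (Submodule.Quotient.mk v') = Submodule.Quotient.mk (f v') := rfl

omit [DecidableEq I] in
/-- **The restriction `M'_{i₀'} → M_{i₀}`** of `f` to the base summands (e.g. the LOCAL norm at the chosen coherent places).
[cite: Brown1982CohomologyGroups, III §5 Prop. (5.3)] -/
def summandMapOfLE : M' i₀' →ₗ[k] M i₀ := (f.comp (M' i₀').subtype).codRestrict (M i₀) fun m' => hf₀ ⟨m', m'.2, rfl⟩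

omit [DecidableEq I] in
/-- `summandMapOfLE m' = f m'` in `V`. [cite: Brown1982CohomologyGroups, III §5 Prop. (5.3)] -/
@[simp] theorem coe_summandMapOfLE (m' : M' i₀') : (summandMapOfLE M i₀ M' i₀' f hf₀ m' : V) = f m' := rfl

omit [DecidableEq I] in
include hf hstab in
/-- The `χ`-relations of the base summands are compatible with `summandMapOfLE` (isotropy of `i₀'` fixes `i₀`).
[cite: Brown1982CohomologyGroups, II §2, III §5 (5.3)] -/
theorem twistRel₀_map_le_of_equivariant :
    (twistRel₀ N' φ' χ M' hperm' i₀').map (summandMapOfLE M i₀ M' i₀' f hf₀) ≤ twistRel₀ N φ χ M hperm i₀ := by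
  rw [Submodule.map_le_iff_le_comap]
  refine Submodule.span_le.mpr ?_
  rintro x ⟨e, m', rfl⟩
  rw [SetLike.mem_coe, Submodule.mem_comap]
  have he : ((e : Υ) : Υ) ∈ stabPre φ i₀ := hstab e.2
  have key : summandMapOfLE M i₀ M' i₀' f hf₀ (isotropyRep N' φ' M' hperm' i₀' (MonoidHom.id _ e) m') =
      isotropyRep N φ M hperm i₀ (MonoidHom.id _ ⟨(e : Υ), he⟩) (summandMapOfLE M i₀ M' i₀' f hf₀ m') := by
    apply Subtype.ext
    rw [coe_summandMapOfLE, MonoidHom.id_apply, MonoidHom.id_apply, coe_isotropyRep_apply, coe_isotropyRep_apply, coe_summandMapOfLE,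
      ← LinearMap.comp_apply, hf, LinearMap.comp_apply]
  rw [map_sub, map_smul, key]
  exact apply_sub_smul_mem_twistRel _ _ _ _ _

omit [DecidableEq I] in
/-- **The map of base-summand coinvariants `(M'_{i₀'})_{χ} → (M_{i₀})_{χ}`** induced by `f`. [cite: Brown1982CohomologyGroups, III §6 (6.2)] -/
def coinvMap₀OfEquivariant : (M' i₀' ⧸ twistRel₀ N' φ' χ M' hperm' i₀') →ₗ[k] (M i₀ ⧸ twistRel₀ N φ χ M hperm i₀) :=
  Submodule.mapQ _ _ (summandMapOfLE M i₀ M' i₀' f hf₀)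
    (Submodule.map_le_iff_le_comap.mp (twistRel₀_map_le_of_equivariant N φ χ M hperm i₀ N' φ' M' hperm' i₀' f hf hf₀ hstab))

omit [DecidableEq I] in
/-- `coinvMap₀OfEquivariant [m'] = [f m']`. [cite: Brown1982CohomologyGroups, III §6 (6.2)] -/
@[simp] theorem coinvMap₀OfEquivariant_mk (m' : M' i₀') :
    coinvMap₀OfEquivariant N φ χ M hperm i₀ N' φ' M' hperm' i₀' f hf hf₀ hstab (Submodule.Quotient.mk m') =
      Submodule.Quotient.mk (summandMapOfLE M i₀ M' i₀' f hf₀ m') := rfl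

omit [DecidableEq I] in
/-- ★ **NATURALITY OF THE SHAPIRO MAP**: `shapiroMap ∘ (f|_{M'_{i₀'}})_{χ} = f_{χ} ∘ shapiroMap'` — the Shapiro maps of two decomposed modules
commute with any equivariant `f : V' → V` carrying the base summand into the base summand (for the semi-local units of a tower: the norm
`U(F_{n'}) → U(F_n)`, whose restriction to `U_{w₀'}` is the local norm into `U_{w₀}`, `w₀ = w₀' ∩ F_n`).
[cite: Brown1982CohomologyGroups, III §6 (6.2) (naturality); III §9] -/
theorem shapiroMap_comp_coinvMap₀OfEquivariant :
    shapiroMap N φ χ M hperm i₀ ∘ₗ coinvMap₀OfEquivariant N φ χ M hperm i₀ N' φ' M' hperm' i₀' f hf hf₀ hstab =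
      coinvMapOfEquivariant N φ χ N' φ' f hf ∘ₗ shapiroMap N' φ' χ M' hperm' i₀' := by
  refine LinearMap.ext fun x => ?_
  induction x using Submodule.Quotient.induction_on with
  | H m' => rfl

variable [DecidableEq I'] (hint' : DirectSum.IsInternal M') (s' : I' → Υ) (hs' : ∀ i, φ' (s' i) • i₀' = i)

/-- ★ **Naturality for the INVERSES**: `P ∘ f_{χ} = (f|_{M'_{i₀'}})_{χ} ∘ P'` — transported `χ`-coinvariants are functorial in the decomposed module
(the form in which the levelwise Shapiro isomorphisms of a tower assemble into a map of inverse systems). [cite: Brown1982CohomologyGroups, III §6 (6.2)] -/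
theorem shapiroInv_comp_coinvMapOfEquivariant :
    shapiroInv N φ χ M hperm i₀ s hs hint ∘ₗ coinvMapOfEquivariant N φ χ N' φ' f hf =
      coinvMap₀OfEquivariant N φ χ M hperm i₀ N' φ' M' hperm' i₀' f hf hf₀ hstab ∘ₗ shapiroInv N' φ' χ M' hperm' i₀' s' hs' hint' := by
  refine LinearMap.ext fun y => ?_
  obtain ⟨x, rfl⟩ := (shapiroMap_bijective N' φ' χ M' hperm' i₀' s' hs' hint').2 y
  rw [LinearMap.comp_apply, LinearMap.comp_apply, shapiroInv_shapiroMap, ← LinearMap.comp_apply (g := shapiroMap N' φ' χ M' hperm' i₀'),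
    ← shapiroMap_comp_coinvMap₀OfEquivariant N φ χ M hperm i₀ N' φ' M' hperm' i₀' f hf hf₀ hstab, LinearMap.comp_apply, shapiroInv_shapiroMap]

/-- The same with the equivalences: `shapiroEquiv⁻¹ ∘ f_{χ} ∘ shapiroEquiv' = (f|_{M'_{i₀'}})_{χ}`. [cite: Brown1982CohomologyGroups, III §6 (6.2)] -/
theorem shapiroEquiv_symm_coinvMapOfEquivariant_shapiroEquiv (x : M' i₀' ⧸ twistRel₀ N' φ' χ M' hperm' i₀') :
    (shapiroEquiv N φ χ M hperm i₀ s hs hint).symm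
        (coinvMapOfEquivariant N φ χ N' φ' f hf (shapiroEquiv N' φ' χ M' hperm' i₀' s' hs' hint' x)) =
      coinvMap₀OfEquivariant N φ χ M hperm i₀ N' φ' M' hperm' i₀' f hf hf₀ hstab x := by
  rw [shapiroEquiv_symm_apply, shapiroEquiv_apply, ← LinearMap.comp_apply (g := shapiroMap N' φ' χ M' hperm' i₀'),
    ← shapiroMap_comp_coinvMap₀OfEquivariant N φ χ M hperm i₀ N' φ' M' hperm' i₀' f hf hf₀ hstab, LinearMap.comp_apply, shapiroInv_shapiroMap]

end Naturality

end InducedModule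

end Literature.Algebra.Homology

end
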